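import Summits.ResolutionOfSingularities.ResolutionOfSingularities.Theorems.UniformWalkTangentCone
import Summits.ResolutionOfSingularities.ResolutionOfSingularities.Theorems.MaxContactCutTightDefect
import Summits.ResolutionOfSingularities.ResolutionOfSingularities.Theorems.MaxContactCutExponentLadder
import HarnessLib

/-!
# MaxContactCutUniformWalks — §4.5 of the decomp-res node «UniformWalks» BY NAME on the host route `MaxContactCut`
(lens-5 g12 REBASED, sha256 00c8d33cfdb7c8ff; critic rows 67/72 CLEARED-FOR-FILING)

Up and down the tree, VERBATIM from the lens file (§4.5): DOWN `sliceTerminate_of_noForcedTowers` /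
`unifFin_of_noForcedTowers` (30253
`MaxContactCut.NoForcedTowers` ⟹ every degree slice / every finite-field certificate, mod `TowerRealisation` +
`CompactnessPort`); UP
`polyPureTowersTerminate_of_finiteFields` (mod `TowerDictionary` + the three ports); KILL `not_walksTerminate_of_unbounded`,
`not_polyPureTowersTerminate_of_unbounded`, `not_noForcedTowers_of_unbounded` (an unbounded finite-field run-length
census at one degree
refutes 30253), `not_e_one_of_unbounded`, `not_rungOne_of_unbounded` (⟹ ¬`E 1`, ¬29273 mod `TowerObstructs` +
`TowerRealisation`).
[WRITER NOTE (decomp-res writer g5): lens §5 `closes` is literally the tree's `MaxContactCutExponentLadder.closes` and lens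
`rungOne_via_forcedTowers` is literally `MaxContactCutForcedTowers.rungOne_of_forced` — cited here, not restated
(gate dedup).  Host
asides 33493 UWFiniteFieldCriterion (`∀ d, ∃ B, UnifFin d B`) / 33494 UWAlgWalksTerminate refining 30253 were added by
route edit rev 26 and are keyed BY NAME in §4.6.]
(Sources: Hauser2010 §§F–G; CossartPiltant2019.)
-/

open CategoryTheory AlgebraicGeometry
open Literature.AlgebraicGeometry.Resolution
open Summit.ResolutionOfSingularities.ResolutionOfSingularities.Theses
open Summit.ResolutionOfSingularities.ResolutionOfSingularities.Theorems
open Summit.ResolutionOfSingularities.ResolutionOfSingularities.Theorems.WeakOrderReduction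
open Summit.ResolutionOfSingularities.ResolutionOfSingularities.Theorems.ForcedTowerClasses
open Summit.ResolutionOfSingularities.ResolutionOfSingularities.Theorems.TightDefectClasses
open Summit.ResolutionOfSingularities.ResolutionOfSingularities.Theorems.MaxContactCutTightDefect

namespace Summit.ResolutionOfSingularities.ResolutionOfSingularities.Theorems.UniformWalks

/-! ## §4 Kernels (PROVED, no sorry) -/

section Kernels

open MvPolynomial
open Literature.AlgebraicGeometry.Resolution.Hauser2010
open Literature.AlgebraicGeometry.Resolution.PointBlowup
open Literature.Barriers.ResolutionOfSingularities

/-! ### 4.5 Up and down the tree: 30253 `NoForcedTowers`, `E 1`, 29273 -/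

/-- **DOWN: 30253 ⟹ every degree slice** (mod `TowerRealisation`). [folklore] -/
theorem sliceTerminate_of_noForcedTowers (hR : TowerRealisation) (h : MaxContactCut.NoForcedTowers) (d : ℕ) :
    SliceTerminate d :=
  sliceTerminate_of_walksTerminate (hR (polyPureTowersTerminate_of_noForcedTowers h)) d

/-- **DOWN: 30253 ⟹ uniform bounds over finite fields exist at every degree** (mod `TowerRealisation`, compactness):
the tree crux PREDICTS that T-unif-1's run lengths are bounded in the field size at each degree. [folklore] -/
theorem unifFin_of_noForcedTowers (hR : TowerRealisation) (hC : CompactnessPort) (h : MaxContactCut.NoForcedTowers) :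
    ∀ d, ∃ B, UnifFin d B := fun d => by
  obtain ⟨B, hB⟩ := (sliceTerminate_iff_exists_unifBound hC d).mp (sliceTerminate_of_noForcedTowers hR h d)
  exact ⟨B, unifFin_of_unifBound hB⟩

/-- **UP: uniform finite-field bounds at every degree ⟹ the slice of 30253** (mod the two ports and the
dictionary). [folklore] -/
theorem polyPureTowersTerminate_of_finiteFields (hD : TowerDictionary) (hC : CompactnessPort)
    (hS : SpecialisationPort) (h : ∀ d, ∃ B, UnifFin d B) : PolyPureTowersTerminate :=
  polyPureTowersTerminate_of_model hD ((finiteFieldCriterion hC hS).mpr h)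

/-- **REFUTATION CHANNEL, model level**: unbounded forced-run lengths over finite fields at ONE degree refute
`WalksTerminate` (mod the ports) — nobody has to exhibit an infinite walk. [folklore] -/
theorem not_walksTerminate_of_unbounded (hC : CompactnessPort) (hS : SpecialisationPort) {d : ℕ}
    (h : ∀ B, ¬ UnifFin d B) : ¬ WalksTerminate := fun hW =>
  (h _) (((finiteFieldCriterion hC hS).mp hW d).choose_spec)

/-- **REFUTATION CHANNEL, slice level**: … hence refute `PolyPureTowersTerminate` (mod `TowerRealisation`). [folklore] -/
theorem not_polyPureTowersTerminate_of_unbounded (hR : TowerRealisation) (hC : CompactnessPort)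
    (hS : SpecialisationPort) {d : ℕ} (h : ∀ B, ¬ UnifFin d B) : ¬ PolyPureTowersTerminate :=
  fun hP => not_walksTerminate_of_unbounded hC hS h (hR hP)

/-- **REFUTATION CHANNEL to the tree item 30253 BY NAME**: unbounded finite-field run lengths at one degree refute
`MaxContactCut.NoForcedTowers`. [folklore] -/
theorem not_noForcedTowers_of_unbounded (hR : TowerRealisation) (hC : CompactnessPort) (hS : SpecialisationPort)
    {d : ℕ} (h : ∀ B, ¬ UnifFin d B) : ¬ MaxContactCut.NoForcedTowers :=
  fun hN => not_polyPureTowersTerminate_of_unbounded hR hC hS h (polyPureTowersTerminate_of_noForcedTowers hN)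

/-- **REFUTATION CHANNEL to `E 1`** (mod the tree port `TowerObstructs`, via the tree kernel
`MaxContactCutForcedTowers.noForcedTowers_of_e_one`). [folklore] -/
theorem not_e_one_of_unbounded (hT : ∀ n : ℕ, 1 ≤ n → TowerObstructs n) (hR : TowerRealisation)
    (hC : CompactnessPort) (hS : SpecialisationPort) {d : ℕ} (h : ∀ B, ¬ UnifFin d B) : ¬ E 1 :=
  fun h1 => not_noForcedTowers_of_unbounded hR hC hS h (MaxContactCutForcedTowers.noForcedTowers_of_e_one hT h1)

/-- **REFUTATION CHANNEL to 29273 `RungOne`** given `E 2`. [folklore] -/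
theorem not_rungOne_of_unbounded (hT : ∀ n : ℕ, 1 ≤ n → TowerObstructs n) (hR : TowerRealisation)
    (hC : CompactnessPort) (hS : SpecialisationPort) {d : ℕ} (h : ∀ B, ¬ UnifFin d B) (h2 : E 2) :
    ¬ MaxContactCut.RungOne :=
  fun hR1 => not_e_one_of_unbounded hT hR hC hS h (hR1 h2)

/-! ### 4.6 The host asides 33493 `UWFiniteFieldCriterion` / 33494 `UWAlgWalksTerminate` BY NAME
[WRITER NOTE (decomp-res writer g5): route edit rev 26 (cb6b2c22) added the two asides refining 30253; this block keys
them to the kernels above — definitional unfoldings (`Iff.rfl`) and one-line applications.] -/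

/-- 33493 unfolds to the finite-field criterion `∀ d, ∃ B, UnifFin d B`. -/
theorem uwFiniteFieldCriterion_iff :
    MaxContactCut.UWFiniteFieldCriterion ↔ ∀ d, ∃ B, UnifFin d B := Iff.rfl

/-- 33494 unfolds to `AlgWalksTerminate`. -/
theorem uwAlgWalksTerminate_iff : MaxContactCut.UWAlgWalksTerminate ↔ AlgWalksTerminate := Iff.rfl

/-- **NECESSARY: 30253 ⟹ 33493** (mod `TowerRealisation` + `CompactnessPort`). [folklore] -/
theorem uwFiniteFieldCriterion_of_noForcedTowers (hR : TowerRealisation) (hC : CompactnessPort)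
    (h : MaxContactCut.NoForcedTowers) : MaxContactCut.UWFiniteFieldCriterion :=
  unifFin_of_noForcedTowers hR hC h

/-- **EXACT at model level: `WalksTerminate ⟺ 33493`** (mod `CompactnessPort` + `SpecialisationPort`). [folklore] -/
theorem walksTerminate_iff_uwFiniteFieldCriterion (hC : CompactnessPort) (hS : SpecialisationPort) :
    WalksTerminate ↔ MaxContactCut.UWFiniteFieldCriterion :=
  finiteFieldCriterion hC hS

/-- **UP: 33493 ⟹ `PolyPureTowersTerminate`** (mod `TowerDictionary` + the two ports). [folklore] -/
theorem polyPureTowersTerminate_of_uwFiniteFieldCriterion (hD : TowerDictionary) (hC : CompactnessPort)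
    (hS : SpecialisationPort) (h : MaxContactCut.UWFiniteFieldCriterion) : PolyPureTowersTerminate :=
  polyPureTowersTerminate_of_finiteFields hD hC hS h

/-- **REFUTATION CHANNEL for 33493, port-free**: unbounded finite-field run lengths at ONE degree refute it
outright. [folklore] -/
theorem not_uwFiniteFieldCriterion_of_unbounded {d : ℕ} (h : ∀ B, ¬ UnifFin d B) :
    ¬ MaxContactCut.UWFiniteFieldCriterion := fun hU => by
  obtain ⟨B, hB⟩ := hU d
  exact h B hB

/-- **33494 from `WalksTerminate`** (instantiation). [folklore] -/
theorem uwAlgWalksTerminate_of_walksTerminate (h : WalksTerminate) : MaxContactCut.UWAlgWalksTerminate :=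
  algWalksTerminate_of_walksTerminate h

/-- **33494 from 30253** (mod `TowerRealisation`). [folklore] -/
theorem uwAlgWalksTerminate_of_noForcedTowers (hR : TowerRealisation) (h : MaxContactCut.NoForcedTowers) :
    MaxContactCut.UWAlgWalksTerminate :=
  algWalksTerminate_of_walksTerminate (hR (polyPureTowersTerminate_of_noForcedTowers h))

/-- **33494 from 33493** (mod the two ports: the criterion gives `WalksTerminate`). [folklore] -/
theorem uwAlgWalksTerminate_of_uwFiniteFieldCriterion (hC : CompactnessPort) (hS : SpecialisationPort)
    (h : MaxContactCut.UWFiniteFieldCriterion) : MaxContactCut.UWAlgWalksTerminate :=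
  algWalksTerminate_of_walksTerminate ((finiteFieldCriterion hC hS).mpr h)

end Kernels

end Summit.ResolutionOfSingularities.ResolutionOfSingularities.Theorems.UniformWalks
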